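import Summits.Ventures.PercRepro.Night2NonFatProfile
import Summits.Ventures.PercRepro.Night2NonFatColoopSum

/-!
# night-2: the NON-FAT case of (FAIR) — the hybrid level-1 criterion: coloop points sharp, the rest by the profile (gen 37)

For `N ≥ 7` every level-1 term is bounded below by the coloop term at a coloop point (`rk (W ∖ y) ≤ 3`:
`1 / (2 · phiM (m₀ y) · #indepPairs y)`, `level_one_term_ge_of_coloop_indep`) and by the profile term elsewhere
(`(11/18 − k_y · 7/30)⁺ / D`, `D = (2/9)(Σ_y k_y)/(N − 2) + 20/9`, the uniform face-sum bound `faceSum_insert_le_uniform` and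
`vCap_insert_ge`).  **`basis_pair_fair_of_coloop_profile`**: the pair is fair as soon as the two sums together reach `1`.
Paper: proofs/NIGHT-2-g37.md §5.
-/

namespace PercRepro.Shadow

open PercRepro.ThmH PercRepro.PerFlat

variable {α : Type*} [DecidableEq α] {M : Matroid α} [M.Finite] {G : Finset α}

/-- **The uniform face-sum bound of the profile** (`N ≥ 7`): `faceSum (Q ∪ {y}) ≤ (2/9)(Σ_y k_y)/(N − 2) + 20/9` for every `y`. -/
theorem faceSum_insert_le_uniform (hG : G ∈ flatsQ M (5 + 1)) (hd : (gr M \ G).card = 2)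
    (hk : kColoops M G = 1) (hnf : fatClosures M 5 G 2 = ∅) {B : Finset α}
    (hB : B ∈ thinMembers M 5 G) (hnP : ¬ bigP M G B) {z : α} (hz : z ∈ G \ clF M B)
    (hN : 7 ≤ (G \ insert z B).card) {y : α} (hy : y ∈ G \ insert z B) :
    faceSum M G (insert y (insert z B)) ≤
      2 / 9 * ((∑ y' ∈ G \ insert z B, (incid M G B z y' : ℚ)) / (((G \ insert z B).card : ℚ) - 2)) + 2 / 9 * 10 := by
  have hd' : (gr M \ G).card ≤ 5 := by omega
  set N : ℕ := (G \ insert z B).card with hNdef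
  set A : Finset α := (insert z B \ coloops M G).filter (fun w => faceOk M G (insert z B) w) with hAdef
  have hNq : (7 : ℚ) ≤ (N : ℚ) := by exact_mod_cast hN
  have hN2 : (0 : ℚ) < (N : ℚ) - 2 := by linarith
  set S : ℚ := ∑ y' ∈ G \ insert z B, (incid M G B z y' : ℚ) with hSdef
  have hsumt : ∑ w ∈ A, (((G \ insert z B).filter (fun y => y ∈ clF M ((insert z B).erase w))).card : ℚ) = S := by
    rw [hSdef, hAdef]
    exact_mod_cast sum_card_filter_eq_sum_incid
  refine le_trans (faceSum_insert_le hG hd hk hnf hB hnP hz hy) ?_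
  apply add_le_add
  · have hterm' : ∀ w ∈ A, phiFace M ((insert z B).erase w) *
        (((insert y (insert z B) \ coloops M G) \ clF M ((insert z B).erase w)).card : ℚ) ≤
        2 * (1 / 9 * ((((G \ insert z B).filter (fun y => y ∈ clF M ((insert z B).erase w))).card : ℚ) /
          ((N : ℚ) - 2))) := by
      intro w hw
      rw [hAdef, Finset.mem_filter] at hw
      have ht := card_filter_clF_erase_le hG hd hk hnf hB hnP hz hw.1 hw.2
      have hm := card_sdiff_clF_erase_ge hG hd hk hB hnP hz hw.1
      have hphi : phiFace M ((insert z B).erase w) ≤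
          phiM (N + 1 - ((G \ insert z B).filter (fun y => y ∈ clF M ((insert z B).erase w))).card) :=
        phiFace_le_of_le hG hd hw.2.1 (by omega)
      have hchord := phiM_le_chord hN ht
      have hc := card_sdiff_clF_erase_le_two hG hB hz y (Finset.mem_sdiff.1 hw.1).1
      have hc' : (((insert y (insert z B) \ coloops M G) \ clF M ((insert z B).erase w)).card : ℚ) ≤ 2 := by
        have : ((insert y (insert z B) \ coloops M G) \ clF M ((insert z B).erase w)).card ≤ 2 := by
          refine le_trans hc ?_
          split_ifs <;> norm_num
        exact_mod_cast this
      have hnn : (0 : ℚ) ≤ 1 / 9 * ((((G \ insert z B).filter (fun y => y ∈ clF M ((insert z B).erase w))).card : ℚ) /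
          ((N : ℚ) - 2)) := by positivity
      calc phiFace M ((insert z B).erase w) *
            (((insert y (insert z B) \ coloops M G) \ clF M ((insert z B).erase w)).card : ℚ)
          ≤ (1 / 9 * ((((G \ insert z B).filter (fun y => y ∈ clF M ((insert z B).erase w))).card : ℚ) /
              ((N : ℚ) - 2))) * 2 := by
            apply mul_le_mul _ hc' (by positivity) hnn
            refine le_trans hphi ?_
            rw [mul_div_assoc] at hchord
            exact hchord
        _ = 2 * (1 / 9 * ((((G \ insert z B).filter (fun y => y ∈ clF M ((insert z B).erase w))).card : ℚ) /
              ((N : ℚ) - 2))) := by ring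
    calc ∑ w ∈ A, phiFace M ((insert z B).erase w) *
          (((insert y (insert z B) \ coloops M G) \ clF M ((insert z B).erase w)).card : ℚ)
        ≤ ∑ w ∈ A, 2 * (1 / 9 * ((((G \ insert z B).filter (fun y => y ∈ clF M ((insert z B).erase w))).card : ℚ) /
            ((N : ℚ) - 2))) := Finset.sum_le_sum hterm'
      _ = 2 / 9 * (∑ w ∈ A, (((G \ insert z B).filter (fun y => y ∈ clF M ((insert z B).erase w))).card : ℚ)) /
            ((N : ℚ) - 2) := by
          rw [Finset.mul_sum, Finset.sum_div]
          apply Finset.sum_congr rfl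
          intro w _
          ring
      _ = 2 / 9 * (S / ((N : ℚ) - 2)) := by rw [hsumt]; ring
  · apply mul_le_mul_of_nonneg_left _ (by norm_num)
    exact_mod_cast card_facesIn_mem_le_ten hG hd hk hB hnP hz hy

open scoped Classical in
/-- **The hybrid criterion**: the sharp coloop terms at the coloop points plus the profile terms elsewhere reach `1`. -/
theorem basis_pair_fair_of_coloop_profile (hG : G ∈ flatsQ M (5 + 1)) (hd : (gr M \ G).card = 2)
    (hk : kColoops M G = 1) (hs : ∀ e ∈ gr M, ∀ f ∈ gr M, e ≠ f → rkN M {e, f} = 2)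
    (hl : ∀ e ∈ gr M, M.Indep {e}) (hnf : fatClosures M 5 G 2 = ∅) {B : Finset α}
    (hB : B ∈ thinMembers M 5 G) (hnP : ¬ bigP M G B) {z : α} (hz : z ∈ G \ clF M B)
    (hl0 : loss M 5 G B z ≠ 0) (hN : 7 ≤ (G \ insert z B).card) (m₀ : α → ℕ)
    (hm : ∀ y ∈ G \ insert z B, rkN M ((G \ insert z B).erase y) ≤ 3 →
      ∀ B' ∈ thinMembers M 5 G, ¬ bigP M G B' → B' ⊆ insert y (insert z B) → m₀ y ≤ (G \ clF M B').card)
    (hsum : 1 ≤ (∑ y ∈ (G \ insert z B).filter (fun y => rkN M ((G \ insert z B).erase y) ≤ 3),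
        1 / (2 * phiM (m₀ y) * ((indepPairs M G B z y).card : ℚ))) +
      ∑ y ∈ (G \ insert z B).filter (fun y => ¬ rkN M ((G \ insert z B).erase y) ≤ 3),
        max 0 (11 / 18 - (incid M G B z y : ℚ) * (7 / 30)) /
          (2 / 9 * ((∑ y' ∈ G \ insert z B, (incid M G B z y' : ℚ)) / (((G \ insert z B).card : ℚ) - 2)) + 2 / 9 * 10)) :
    loss M 5 G B z ≤ rhoL M 5 G B z * lossIncomeH M 5 G (bigP M G) (dshGT2 M 5 G) B z := by
  have hfat : (fatClosures M 5 G 2).card ≤ 1 := by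
    rw [hnf, Finset.card_empty]
    exact zero_le_one
  apply basis_pair_fair_of_level_one_sum hG hd hk hs hl hfat hB hnP hz hl0
  set D : ℚ := 2 / 9 * ((∑ y' ∈ G \ insert z B, (incid M G B z y' : ℚ)) / (((G \ insert z B).card : ℚ) - 2)) +
    2 / 9 * 10 with hDdef
  have hNq : (7 : ℚ) ≤ ((G \ insert z B).card : ℚ) := by exact_mod_cast hN
  have hDpos : 0 < D := by
    rw [hDdef]
    have : 0 ≤ (∑ y' ∈ G \ insert z B, (incid M G B z y' : ℚ)) / (((G \ insert z B).card : ℚ) - 2) :=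
      div_nonneg (Finset.sum_nonneg (fun y _ => by positivity)) (by linarith)
    linarith
  -- the per-point lower bounds
  have hcol : ∀ y ∈ (G \ insert z B).filter (fun y => rkN M ((G \ insert z B).erase y) ≤ 3),
      1 / (2 * phiM (m₀ y) * ((indepPairs M G B z y).card : ℚ)) ≤
        vCap M G (insert y (insert z B)) / faceSum M G (insert y (insert z B)) := by
    intro y hy
    rw [Finset.mem_filter] at hy
    exact level_one_term_ge_of_coloop_indep hG hd hk hs hl hB hnP hz hl0 hy.1 hy.2 (hm y hy.1 hy.2)
  have hprof : ∀ y ∈ (G \ insert z B).filter (fun y => ¬ rkN M ((G \ insert z B).erase y) ≤ 3),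
      max 0 (11 / 18 - (incid M G B z y : ℚ) * (7 / 30)) / D ≤
        vCap M G (insert y (insert z B)) / faceSum M G (insert y (insert z B)) := by
    intro y hy
    rw [Finset.mem_filter] at hy
    have hface := faceSum_insert_le_uniform hG hd hk hnf hB hnP hz hN hy.1
    have hcap : max 0 (11 / 18 - (incid M G B z y : ℚ) * (7 / 30)) ≤ vCap M G (insert y (insert z B)) := by
      apply max_le (vCap_nonneg _)
      have hv := vCap_insert_ge hG hd hk hs hl hB hnP hz hy.1
      have hL1 : ∑ w ∈ (insert z B \ coloops M G).filter
          (fun w => faceOk M G (insert z B) w ∧ y ∈ clF M ((insert z B).erase w)), req M 5 ((insert z B).erase w) ≤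
          (incid M G B z y : ℚ) * (7 / 30) := by
        unfold incid
        have hfilt : (insert z B \ coloops M G).filter
            (fun w => faceOk M G (insert z B) w ∧ y ∈ clF M ((insert z B).erase w)) =
            ((insert z B \ coloops M G).filter (fun w => faceOk M G (insert z B) w)).filter
              (fun w => y ∈ clF M ((insert z B).erase w)) := by
          rw [Finset.filter_filter]
        rw [hfilt]
        calc ∑ w ∈ ((insert z B \ coloops M G).filter (fun w => faceOk M G (insert z B) w)).filter
              (fun w => y ∈ clF M ((insert z B).erase w)), req M 5 ((insert z B).erase w)
            ≤ ∑ _w ∈ ((insert z B \ coloops M G).filter (fun w => faceOk M G (insert z B) w)).filter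
              (fun w => y ∈ clF M ((insert z B).erase w)), (7 / 30 : ℚ) := by
              apply Finset.sum_le_sum
              intro w hw
              rw [Finset.mem_filter, Finset.mem_filter] at hw
              exact req_le_of_nonfat hG hd hnf hw.1.2.1
          _ = _ := by rw [Finset.sum_const, nsmul_eq_mul]
      linarith
    have hpos := faceSum_pos_of_mem_tgtSets hG hd hk hB hnP hz hl0
      (level_one_targets_subset hG hB hz (Finset.mem_image.2 ⟨y, hy.1, rfl⟩))
    rw [div_le_div_iff₀ hDpos hpos]
    have h3 : 0 ≤ max 0 (11 / 18 - (incid M G B z y : ℚ) * (7 / 30)) := le_max_left _ _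
    nlinarith [vCap_nonneg (M := M) (G := G) (insert y (insert z B))]
  -- assemble: the two filters partition `W`
  rw [← Finset.sum_filter_add_sum_filter_not (G \ insert z B) (fun y => rkN M ((G \ insert z B).erase y) ≤ 3)]
  calc (1 : ℚ) ≤ _ := hsum
    _ ≤ (∑ y ∈ (G \ insert z B).filter (fun y => rkN M ((G \ insert z B).erase y) ≤ 3),
          vCap M G (insert y (insert z B)) / faceSum M G (insert y (insert z B))) +
        ∑ y ∈ (G \ insert z B).filter (fun y => ¬ rkN M ((G \ insert z B).erase y) ≤ 3),
          vCap M G (insert y (insert z B)) / faceSum M G (insert y (insert z B)) :=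
        add_le_add (Finset.sum_le_sum hcol) (Finset.sum_le_sum hprof)

end PercRepro.Shadow
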